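import Summits.QuantumAdvantage.QuantumAdvantage.Theorems.LinnikCubicClassGroupsDegreeOnePrimesEscapeFrobeniusPsiSignedAll
import Summits.QuantumAdvantage.QuantumAdvantage.Theorems.LinnikCubicClassGroupsDegreeOnePrimesEscapeFrobeniusLeastDegOnePrime
import HarnessLib

/-!
# The least degree-one prime with prescribed Frobenius in a cyclic extension — EVERY base field

Topic `Summits/QuantumAdvantage/QuantumAdvantage/Theorems`, cell B2b-1 (linnik-cubic), PART A (gen 16); helper
toward the crux `DegreeOnePrimesEscape` (stmt-QuantumAdvantage-11543) — the E-side input for the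
Lagarias–Montgomery–Odlyzko theorem over an ARBITRARY base field (`…ChebotarevElementRelative.lean`).
HONEST FRAMING: the value of this file is a THEOREM (kernel-checked, GRH-free) — NOT summit progress.

`exists_degOnePrime_galFrob_eq_absNorm_le` (`…FrobeniusLeastDegOnePrime.lean`, gen 12) carries the hypothesis
`1 < [E:ℚ]`, inherited from `frobeniusPsi_dichotomy`; gen 13 re-proved the dichotomy for every base
(`frobeniusPsi_dichotomy_signed_all`).  Here the hypothesis is dropped from the least-prime theorem as well:

**Theorem** (`exists_degOnePrime_galFrob_eq_absNorm_le_all`).  For `n > 1` there is `L = L(n) > 0` such that for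
every cyclic extension `N|E` of number fields with `[N:ℚ] = n` (ANY base `E`, `E = ℚ` included) and every
`τ ∈ Gal(N|E)` there is a prime `𝔭` of `E`, unramified in `N`, with `Frob_𝔭 = τ`, `N𝔭 = p` a rational prime,
`p ∤ d_N`, and `p ≤ Q^{L}`, `Q = |d_N| nⁿ`.  [Weiss1983, Theorem 6.1]; [LagariasMontgomeryOdlyzko1979, Theorem 1.1, §3].
Proof: verbatim the gen-12 proof, fed with `frobeniusPsi_dichotomy_all` (the projection of
`frobeniusPsi_dichotomy_signed_all` forgetting the sign clause).
-/


noncomputable section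

open Complex Real Finset NumberField IsDedekindDomain
open scoped NumberField nonZeroDivisors Classical

namespace Summit.QuantumAdvantage.QuantumAdvantage.Theorems.DegreeOnePrimesEscape

open Literature.NumberTheory.LFunctions Literature.NumberTheory.LFunctions.NumberField
  Literature.NumberTheory.LFunctions.EntireEF Literature.NumberTheory.LFunctions.TZWeight
  Literature.NumberTheory.LFunctions.AbelianDensity Literature.NumberTheory.GaloisRepresentations

variable {E N : Type} [Field E] [NumberField E] [Field N] [NumberField N] [Algebra E N] [IsGalois E N]

/-- `frobeniusPsi_dichotomy` (`…FrobeniusPsi.lean`) for EVERY base field `E` (the hypothesis `1 < [E:ℚ]` dropped):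
the projection of `frobeniusPsi_dichotomy_signed_all` forgetting the sign clause.
[cite: LagariasMontgomeryOdlyzko1979, §7, Theorem 1.1] [cite: ThornerZaman2019, Theorem 1.4] -/
theorem frobeniusPsi_dichotomy_all (n₀ : ℕ) (hn₀ : 1 < n₀) {η : ℝ} (hη : 0 < η) :
    ∃ a₂ c : ℝ, 1 ≤ a₂ ∧ 0 < c ∧ c ≤ 1 / (8 * ((n₀ : ℝ) ^ 2 + 1)) ∧
    ∀ (E N : Type) [Field E] [NumberField E] [Field N] [NumberField N] [Algebra E N] [IsGalois E N]
      [IsCyclic (N ≃ₐ[E] N)], Module.finrank ℚ N = n₀ →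
    ∃ χ₁ : (N ≃ₐ[E] N) →* ℂˣ, Function.Injective χ₁ ∧
      (∀ (τ : N ≃ₐ[E] N) (wτ : Ideal (𝓞 E) → ℝ),
        (∀ I, wτ I = if (∃ v : HeightOneSpectrum (𝓞 E), Algebra.IsUnramifiedIn (𝓞 N) v.asIdeal ∧
          ∃ k : ℕ, I = v.asIdeal ^ k ∧ galFrob E N v ^ k = τ) then 1 else 0) →
        ∀ x : ℝ, ThornerZaman.condQn N ^ a₂ ≤ x →
          (¬ ∃ β₁ : ℝ, dedekindZeta₁ N β₁ = 0 ∧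
            1 - c / (Real.log ((NumberField.discr N).natAbs : ℝ) + Real.log 4) < β₁ ∧ β₁ < 1) →
          |(Module.finrank E N : ℝ) * (∑ n ∈ Icc 0 ⌊x⌋₊, ∑ I ∈ idealsOfNorm E n, wτ I * idealVonMangoldt I) - x| ≤
            η * x) ∧
      (∀ β₁ : ℝ, dedekindZeta₁ N β₁ = 0 →
          1 - c / (Real.log ((NumberField.discr N).natAbs : ℝ) + Real.log 4) < β₁ → β₁ < 1 →
        ∃ j₀ : ℕ, j₀ < Module.finrank E N ∧
        ∀ (τ : N ≃ₐ[E] N) (wτ : Ideal (𝓞 E) → ℝ),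
          (∀ I, wτ I = if (∃ v : HeightOneSpectrum (𝓞 E), Algebra.IsUnramifiedIn (𝓞 N) v.asIdeal ∧
            ∃ k : ℕ, I = v.asIdeal ^ k ∧ galFrob E N v ^ k = τ) then 1 else 0) →
          ∀ x : ℝ, ThornerZaman.condQn N ^ a₂ ≤ x →
            |(Module.finrank E N : ℝ) * (∑ n ∈ Icc 0 ⌊x⌋₊, ∑ I ∈ idealsOfNorm E n, wτ I * idealVonMangoldt I) -
                (x - ((((χ₁ τ : ℂˣ) : ℂ)⁻¹) ^ j₀).re * x ^ β₁ / β₁)| ≤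
              η * x * min 1 ((1 - β₁) * Real.log x)) := by
  obtain ⟨a₂, c, c', ha₂, hc, hcn, -, -, h⟩ := frobeniusPsi_dichotomy_signed_all n₀ hn₀ hη
  refine ⟨a₂, c, ha₂, hc, hcn, fun E N _ _ _ _ _ _ _ hNn ↦ ?_⟩
  obtain ⟨χ₁, hχ₁, hA, hB, -⟩ := h E N hNn
  exact ⟨χ₁, hχ₁, hA, hB⟩

set_option maxHeartbeats 1600000 in
/-- **The least degree-one prime with prescribed Frobenius in a cyclic extension, avoiding `d_N`, EVERY base `E`**
(see the module docstring): `exists_degOnePrime_galFrob_eq_absNorm_le` without the hypothesis `1 < [E:ℚ]`.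
[cite: Weiss1983, Theorem 6.1] [cite: LagariasMontgomeryOdlyzko1979, Theorem 1.1] -/
theorem exists_degOnePrime_galFrob_eq_absNorm_le_all (n₀ : ℕ) (hn₀ : 1 < n₀) :
    ∃ L : ℝ, 0 < L ∧
    ∀ (E N : Type) [Field E] [NumberField E] [Field N] [NumberField N] [Algebra E N] [IsGalois E N]
      [IsCyclic (N ≃ₐ[E] N)], Module.finrank ℚ N = n₀ →
    ∀ τ : N ≃ₐ[E] N, ∃ v : HeightOneSpectrum (𝓞 E), Algebra.IsUnramifiedIn (𝓞 N) v.asIdeal ∧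
      galFrob E N v = τ ∧ (Ideal.absNorm v.asIdeal).Prime ∧ ¬ ((Ideal.absNorm v.asIdeal : ℤ) ∣ NumberField.discr N) ∧
      (Ideal.absNorm v.asIdeal : ℝ) ≤ ThornerZaman.condQn N ^ L := by
  classical
  obtain ⟨a₂, c, ha₂1, hc, hcn, hmain⟩ := frobeniusPsi_dichotomy_all n₀ hn₀ (by norm_num : (0 : ℝ) < 1 / 16)
  obtain ⟨c₁, hc₁, hc₁1, heff⟩ := Residue.one_sub_realZero_ge_condQn_rpow n₀ hn₀
  have hn2 : (2 : ℝ) ≤ n₀ := by exact_mod_cast hn₀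
  -- thresholds
  set Λp : ℝ := max 0 (Real.log (1024 * n₀ / (3 * c₁))) with hΛp
  set Λd : ℝ := max 0 (Real.log (128 * n₀ / (3 * c₁))) with hΛd
  set L : ℝ := max (max a₂ 32) (max (4 * (2 + Λp)) (4 + Λd)) with hLdef
  have hLa₂ : a₂ ≤ L := le_trans (le_max_left _ _) (le_max_left _ _)
  have hL32 : (32 : ℝ) ≤ L := le_trans (le_max_right _ _) (le_max_left _ _)
  have hLp : 4 * (2 + Λp) ≤ L := le_trans (le_max_left _ _) (le_max_right _ _)
  have hLd : 4 + Λd ≤ L := le_trans (le_max_right _ _) (le_max_right _ _)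
  refine ⟨L, by linarith, ?_⟩
  intro E N _ _ _ _ _ _ _ hNn τ
  obtain ⟨χ₁, hχ₁, hcaseA, hcaseB⟩ := hmain E N hNn
  haveI : FiniteDimensional E N := Module.Finite.of_restrictScalars_finite ℚ E N
  have hN : 1 < Module.finrank ℚ N := by rw [hNn]; exact hn₀
  set mN : ℕ := Module.finrank E N with hmN
  have hm1 : 1 ≤ mN := Module.finrank_pos
  have hdeg : Module.finrank ℚ N = Module.finrank ℚ E * mN := (Module.finrank_mul_finrank ℚ E N).symm
  have hnEm : (Module.finrank ℚ E : ℝ) * mN = n₀ := by rw [← hNn, hdeg]; push_cast; ring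
  have hm0 : (0 : ℝ) ≤ mN := Nat.cast_nonneg _
  set Q : ℝ := ThornerZaman.condQn N with hQ
  have hQ12 : (12 : ℝ) ≤ Q := ThornerZaman.twelve_le_condQn (K := N) hN
  have hQ1 : (1 : ℝ) < Q := by linarith
  have hQ0 : (0 : ℝ) < Q := by linarith
  have hlogQ : 2 ≤ Real.log Q := two_lt_log_twelve.le.trans (Real.log_le_log (by norm_num) hQ12)
  set x : ℝ := Q ^ L with hxdef
  have hxa₂ : Q ^ a₂ ≤ x := Real.rpow_le_rpow_of_exponent_le hQ1.le hLa₂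
  have hxQ : Q ≤ x := by
    have := Real.rpow_le_rpow_of_exponent_le hQ1.le (by linarith : (1 : ℝ) ≤ L); rwa [Real.rpow_one] at this
  have hx1 : 1 < x := by linarith
  have hx0 : 0 < x := by linarith
  have hLx : L * Real.log Q = Real.log x := by rw [hxdef, Real.log_rpow hQ0]
  have hlog16 : 16 ≤ Real.log x := by rw [← hLx]; nlinarith
  -- Stark
  set m' : ℝ := c₁ * Q ^ (-(2 : ℝ)) with hm'
  have hQm2 : Q ^ (-(2 : ℝ)) ≤ 1 := Real.rpow_le_one_of_one_le_of_nonpos hQ1.le (by norm_num)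
  have hQm2' : 0 < Q ^ (-(2 : ℝ)) := Real.rpow_pos_of_pos hQ0 _
  have hm'0 : 0 < m' := mul_pos hc₁ hQm2'
  have hm'1 : m' ≤ 1 := (mul_le_mul hc₁1 hQm2 hQm2'.le zero_le_one).trans (by norm_num)
  have hm'2 : m' = c₁ * (Q ^ (2 : ℝ))⁻¹ := by rw [hm', Real.rpow_neg hQ0.le]
  -- the weight and the LOWER BOUND `(3/16) x m' ≤ m ψ_τ(x)` (verbatim from `exists_prime_galFrob_eq_absNorm_le`)
  set wτ : Ideal (𝓞 E) → ℝ := fun I ↦ if (∃ v : HeightOneSpectrum (𝓞 E), Algebra.IsUnramifiedIn (𝓞 N) v.asIdeal ∧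
      ∃ k : ℕ, I = v.asIdeal ^ k ∧ galFrob E N v ^ k = τ) then 1 else 0 with hwτdef
  have hwτ : ∀ I, wτ I = if (∃ v : HeightOneSpectrum (𝓞 E), Algebra.IsUnramifiedIn (𝓞 N) v.asIdeal ∧
      ∃ k : ℕ, I = v.asIdeal ^ k ∧ galFrob E N v ^ k = τ) then 1 else 0 := fun I ↦ rfl
  set Ψ : ℝ := ∑ n ∈ Icc 0 ⌊x⌋₊, ∑ I ∈ idealsOfNorm E n, wτ I * idealVonMangoldt I with hΨ
  have hlow : 3 / 16 * x * m' ≤ (mN : ℝ) * Ψ := by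
    by_cases hexc : ∃ β₁ : ℝ, dedekindZeta₁ N β₁ = 0 ∧
        1 - c / (Real.log ((NumberField.discr N).natAbs : ℝ) + Real.log 4) < β₁ ∧ β₁ < 1
    · obtain ⟨β₁, hζ, hwin, hβ1⟩ := hexc
      obtain ⟨j₀, -, hB⟩ := hcaseB β₁ hζ hwin hβ1
      have h1 := hB τ wτ hwτ x hxa₂
      set r : ℝ := ((((χ₁ τ : ℂˣ) : ℂ)⁻¹) ^ j₀).re with hr
      have hrle : |r| ≤ 1 := by
        refine (Complex.abs_re_le_norm _).trans ?_
        rw [norm_pow]; exact pow_le_one₀ (norm_nonneg _) (norm_inv_character_le_one χ₁ τ)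
      have hβ1ne : ((β₁ : ℝ) : ℂ) ≠ 1 := by intro h'; apply hβ1.ne; exact_mod_cast h'
      have hLzero : classGroupLFunction N 1 β₁ = 0 := by
        have := classGroupLFunction_eq_zero_of_famF (K := N) 0 (ρ := (β₁ : ℂ)) (by rw [famF_zero]; exact hζ) hβ1ne
        rwa [toHomUnits_toMulHom_zero] at this
      have h11 : (1 : ClassGroup (𝓞 N) →* ℂˣ) * 1 = 1 := by ext; simp
      have hδlow : m' ≤ 1 - β₁ := heff N hNn 1 h11 β₁ hβ1 hLzero
      have hβhalf : 1 / 2 ≤ β₁ := by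
        have hlog4 : 1 < Real.log 4 := by
          rw [show (4:ℝ) = 2 ^ 2 by norm_num, Real.log_pow]; have := Real.log_two_gt_d9; push_cast; linarith
        have hlogd : 0 ≤ Real.log ((NumberField.discr N).natAbs : ℝ) := Real.log_natCast_nonneg _
        have hc2 : c ≤ 1 / 2 :=
          hcn.trans (by rw [div_le_div_iff_of_pos_left one_pos (by positivity) (by norm_num)]; nlinarith)
        have : c / (Real.log ((NumberField.discr N).natAbs : ℝ) + Real.log 4) ≤ 1 / 2 := by
          rw [div_le_iff₀ (by linarith)]; nlinarith
        linarith
      have hβ0 : 0 < β₁ := by linarith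
      set mm : ℝ := min 1 ((1 - β₁) * Real.log x) with hmm
      have hmm' : m' ≤ mm := by
        refine le_min hm'1 (hδlow.trans ?_)
        have := mul_le_mul_of_nonneg_left (by linarith : (1 : ℝ) ≤ Real.log x) (by linarith : (0 : ℝ) ≤ 1 - β₁)
        linarith
      have hmm1 : mm ≤ 1 := min_le_left _ _
      have hmm0 : 0 ≤ mm := hm'0.le.trans hmm'
      have h1' := (abs_sub_le_iff.1 h1).2
      have hmain : x / 4 * mm ≤ x - r * x ^ β₁ / β₁ := by
        rcases le_or_gt (3 / 4 : ℝ) β₁ with hβ34 | hβ34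
        · exact sub_mul_rpow_div_ge hx1 hlog16 hβ34 hβ1 hrle
        · have hxβ : x ^ β₁ ≤ x ^ (3 / 4 : ℝ) := Real.rpow_le_rpow_of_exponent_le hx1.le hβ34.le
          have hx34 : x ^ (3 / 4 : ℝ) * 4 ≤ x := by
            have h14 : (4 : ℝ) ≤ x ^ (1 / 4 : ℝ) := by
              have : Real.exp 4 ≤ x ^ (1 / 4 : ℝ) := by
                rw [Real.rpow_def_of_pos hx0]; exact Real.exp_le_exp.2 (by nlinarith)
              linarith [Real.add_one_le_exp (4 : ℝ)]
            have e : x ^ (3 / 4 : ℝ) * x ^ (1 / 4 : ℝ) = x := by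
              rw [← Real.rpow_add hx0]; norm_num
            nlinarith [Real.rpow_pos_of_pos hx0 (3 / 4 : ℝ)]
          have hr1 : r ≤ 1 := (abs_le.1 hrle).2
          have hxβ0 : 0 < x ^ β₁ := Real.rpow_pos_of_pos hx0 _
          have hq : r * x ^ β₁ / β₁ ≤ 2 * x ^ β₁ := by
            rw [div_le_iff₀ hβ0]
            nlinarith
          have : x / 4 * mm ≤ x / 4 := by nlinarith
          nlinarith
      have hmm16 : 1 / 16 * x * mm ≥ 0 := by positivity
      nlinarith [mul_le_mul_of_nonneg_left hmm' (by positivity : (0:ℝ) ≤ 3 / 16 * x)]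
    · have h1 := hcaseA τ wτ hwτ x hxa₂ hexc
      have h1' := (abs_sub_le_iff.1 h1).2
      have : 3 / 16 * x * m' ≤ 3 / 16 * x := by nlinarith
      linarith
  -- the three junk terms, each `≤ (3/64) x m'`
  have hth := mul_rpow_neg_le_one_of_threshold (k := 2) (M := 1024 * n₀ / (3 * c₁)) (ν := 1 / 4) hQ12
    (le_of_eq hxdef.symm) (by norm_num) (by positivity) (by rw [← hΛp]; linarith)
  have hsq : Real.sqrt x * x ^ (1 / 4 : ℝ) = x * x ^ (-(1 / 4 : ℝ)) := by
    rw [Real.sqrt_eq_rpow, ← Real.rpow_add hx0, ← Real.rpow_one_add' hx0.le (by norm_num)]; norm_num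
  have hlog : Real.log x ≤ x ^ (1 / 4 : ℝ) / (1 / 4) := Real.log_le_rpow_div hx0.le (by norm_num)
  have hlogx0 : 0 ≤ Real.log x := Real.log_nonneg hx1.le
  have h34 : 16 * n₀ * (x * x ^ (-(1 / 4 : ℝ))) ≤ 3 / 64 * x * m' := by
    calc 16 * n₀ * (x * x ^ (-(1 / 4 : ℝ)))
        = (1024 * n₀ / (3 * c₁) * Q ^ (2 : ℝ) * x ^ (-(1 / 4 : ℝ))) * (3 / 64 * x * m') := by
          rw [hm'2]; field_simp; ring
      _ ≤ 1 * (3 / 64 * x * m') := mul_le_mul_of_nonneg_right hth (by positivity)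
      _ = 3 / 64 * x * m' := one_mul _
  -- (1) prime powers
  have hJ1 : (mN : ℝ) * (chebyshevPsiIdeal E x - chebyshevThetaIdeal E x) ≤ 3 / 64 * x * m' := by
    have h1 := chebyshevPsiIdeal_sub_chebyshevThetaIdeal_le E hx1.le
    have h2 := primeIdealCount_le_two_mul_finrank_mul E (Real.sqrt_nonneg x)
    calc (mN : ℝ) * (chebyshevPsiIdeal E x - chebyshevThetaIdeal E x)
        ≤ mN * ((2 * Module.finrank ℚ E * Real.sqrt x) * Real.log x) :=
          mul_le_mul_of_nonneg_left (h1.trans (mul_le_mul_of_nonneg_right h2 hlogx0)) hm0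
      _ = 2 * n₀ * Real.sqrt x * Real.log x := by rw [← hnEm]; ring
      _ ≤ 2 * n₀ * Real.sqrt x * (x ^ (1 / 4 : ℝ) / (1 / 4)) := mul_le_mul_of_nonneg_left hlog (by positivity)
      _ = 8 * n₀ * (x * x ^ (-(1 / 4 : ℝ))) := by rw [← hsq]; ring
      _ ≤ 16 * n₀ * (x * x ^ (-(1 / 4 : ℝ))) := by
          nlinarith [show (0 : ℝ) ≤ x * x ^ (-(1 / 4 : ℝ)) by positivity]
      _ ≤ 3 / 64 * x * m' := h34
  -- (2) primes of degree ≥ 2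
  have hJ2 : (mN : ℝ) * ∑ P ∈ (finite_primeIdealsLE E x).toFinset with ¬ (Ideal.absNorm P).Prime,
      Real.log (Ideal.absNorm P : ℝ) ≤ 3 / 64 * x * m' := by
    have h1 := sum_log_absNorm_not_prime_le (E := E) hx1.le
    have hsx : Real.sqrt x + 1 ≤ 2 * Real.sqrt x := by
      have : 1 ≤ Real.sqrt x := by rw [Real.le_sqrt zero_le_one hx0.le]; linarith
      linarith
    calc (mN : ℝ) * ∑ P ∈ (finite_primeIdealsLE E x).toFinset with ¬ (Ideal.absNorm P).Prime, Real.log (Ideal.absNorm P : ℝ)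
        ≤ mN * (Module.finrank ℚ E * (Real.sqrt x + 1) * Real.log x) := mul_le_mul_of_nonneg_left h1 hm0
      _ = n₀ * (Real.sqrt x + 1) * Real.log x := by rw [← hnEm]; ring
      _ ≤ n₀ * (2 * Real.sqrt x) * (x ^ (1 / 4 : ℝ) / (1 / 4)) :=
          mul_le_mul (mul_le_mul_of_nonneg_left hsx (by positivity)) hlog hlogx0 (by positivity)
      _ = 8 * n₀ * (x * x ^ (-(1 / 4 : ℝ))) := by rw [← hsq]; ring
      _ ≤ 16 * n₀ * (x * x ^ (-(1 / 4 : ℝ))) := by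
          nlinarith [show (0 : ℝ) ≤ x * x ^ (-(1 / 4 : ℝ)) by positivity]
      _ ≤ 3 / 64 * x * m' := h34
  -- (3) degree-one primes over `p ∣ d_N`: `n₀ ω(d_N) log d_N ≤ 2 n₀ Q² ≤ (3/64) x m'`
  have hJ3 : (mN : ℝ) * ∑ P ∈ (finite_primeIdealsLE E x).toFinset with
      ((Ideal.absNorm P).Prime ∧ ((Ideal.absNorm P : ℤ) ∣ NumberField.discr N)), Real.log (Ideal.absNorm P : ℝ) ≤
      3 / 64 * x * m' := by
    have h1 := sum_log_absNorm_prime_dvd_le (E := E) (N := N) x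
    obtain ⟨hlogd0, hlogd⟩ := log_natAbs_discr_mem N
    rw [← hQ] at hlogd
    have hω : (((NumberField.discr N).natAbs.primeFactors.card : ℕ) : ℝ) ≤ Q := by
      have hω1 : (NumberField.discr N).natAbs.primeFactors.card ≤ (NumberField.discr N).natAbs := by
        calc (NumberField.discr N).natAbs.primeFactors.card ≤ (Finset.Icc 1 (NumberField.discr N).natAbs).card :=
              Finset.card_le_card fun p hp ↦ Finset.mem_Icc.mpr
                ⟨(Nat.prime_of_mem_primeFactors hp).one_lt.le, Nat.le_of_mem_primeFactors hp⟩
          _ = (NumberField.discr N).natAbs := by simp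
      have h2 : ((NumberField.discr N).natAbs : ℝ) ≤ Q := by rw [hQ]; exact natAbs_discr_le_condQn N
      exact le_trans (by exact_mod_cast hω1) h2
    have hth' := mul_rpow_neg_le_one_of_threshold (k := 4) (M := 128 * n₀ / (3 * c₁)) (ν := 1) hQ12
      (le_of_eq hxdef.symm) (by norm_num) (by positivity) (by rw [← hΛd]; linarith)
    have hx1' : x ^ (-(1 : ℝ)) = x⁻¹ := Real.rpow_neg_one x
    calc (mN : ℝ) * ∑ P ∈ (finite_primeIdealsLE E x).toFinset with
          ((Ideal.absNorm P).Prime ∧ ((Ideal.absNorm P : ℤ) ∣ NumberField.discr N)), Real.log (Ideal.absNorm P : ℝ)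
        ≤ mN * (Module.finrank ℚ E * ((NumberField.discr N).natAbs.primeFactors.card) *
            Real.log ((NumberField.discr N).natAbs : ℝ)) := mul_le_mul_of_nonneg_left h1 hm0
      _ = n₀ * (((NumberField.discr N).natAbs.primeFactors.card) * Real.log ((NumberField.discr N).natAbs : ℝ)) := by
          rw [← hnEm]; ring
      _ ≤ n₀ * (Q * Q) := mul_le_mul_of_nonneg_left (mul_le_mul hω (by linarith) hlogd0 hQ0.le) (by positivity)
      _ = (128 * n₀ / (3 * c₁) * Q ^ (4 : ℝ) * x ^ (-(1 : ℝ))) * (3 / 128 * x * m') := by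
          rw [hm'2, hx1', show (Q ^ (4 : ℝ)) = Q ^ (4 : ℕ) by exact_mod_cast Real.rpow_natCast Q 4,
            show (Q ^ (2 : ℝ)) = Q ^ (2 : ℕ) by exact_mod_cast Real.rpow_natCast Q 2]
          field_simp
      _ ≤ 1 * (3 / 128 * x * m') := mul_le_mul_of_nonneg_right hth' (by positivity)
      _ ≤ 3 / 64 * x * m' := by have : 0 < x * m' := mul_pos hx0 hm'0; linarith
  -- conclusion
  by_contra hno
  push Not at hno
  have hle := psiWeighted_le_of_forall_degOne τ hwτ hx0.le
    (fun v hunr hfrob hp hnd ↦ hno v hunr hfrob hp hnd)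
  have hfin := mul_le_mul_of_nonneg_left hle hm0
  rw [← hΨ, mul_add, mul_add] at hfin
  have hxm : 0 < x * m' := mul_pos hx0 hm'0
  linarith

end Summit.QuantumAdvantage.QuantumAdvantage.Theorems.DegreeOnePrimesEscape
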